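import Mathlib

/-!
# R23 — THE NODE PACKAGE AS A FAN GAME · pinch counts · scar persistence
(bookkeeping companion of `R23-SCARS-AND-FANS.md`, card `Ideas/toric-towers.md` ROUND 23)

[OURS · L1 W4.5b · IDEATOR 1 (res-L1-w45b-idea-1) g32 · 2026-08-29]  AI-written; nothing is attributed to [Hironaka2017];
EL♮(3) is NOT proved; counted 0.  Parts A–D are exact integer bookkeeping (`decide` / `norm_num` / `ring`); Part E is a
three-line piece of local algebra over Mathlib (scar persistence).  No algebraic geometry of the route is formalised here.

* Part A — the support function `h k (a,b,c) = min (2a+2b) (2kc)` of the Newton segment `S_k = [(2,2,0),(0,0,2k)]` of the node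
  germ `α(uv)² + ε y^{2k}` (species (N_k)), regular star subdivisions, `ord` (≥ 2 = singular-locus centre), and the REPLAY of
  the optimal nodes-first words found by `nodegame_sym.py` for `k = 1, 2, 3`: every starred face is singular when starred, the
  final fan is regular and `h k` is linear on every maximal cone (strict transform regular near the node).
* Part B — carriers-first walls `a + b = j·c`: the face `cone((j,0,1),(0,j,1))` has lattice index `j` (transversal `A_{j-1}`
  line), the segment direction `(2,2,2k)` has lattice length `2` (two points per node on the `j = k` line), linearity of
  `h k` on the wall pieces, and the non-linearity certificate on the quadric cone for `k ≥ 2`.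
* Part C — pinch points are mixed volumes: `MV(Δ(D), T(8+k,16+2k)) = 64 + 8k` (= 72 for k = 1, lead-1 j323456; 80 for k = 2).
* Part D — the measured optimum table `(k, local moves per node, global rounds)` for `k = 1..5` and the law
  `L(k) = k(k-1)/2, G(k) = k` (k ≥ 2); Q47_k nodes-first word length `2 + 9·L + G = 13, 32, 60, 97`.
* Part E — SCAR PERSISTENCE: `ϖ ∈ 𝔪_A²` and `φ : A →+* B` local ⇒ `φ ϖ ∈ 𝔪_B²` (so a point of a later stage lying over a
  point where the special fibre is singular is again such a point, whenever the later local ring is regular of dim ≥ 1 —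
  the non-regularity half is ✓p569735 `LiftCore.not_isRegularLocalRing_quotient_sup_span_of_mem_sq`, lead-1, cited not restated).
-/

set_option linter.dupNamespace false -- mandated namespace `Summit.<Summit>.<Problem>` of this single-conjunct summit

namespace Summit.ResolutionOfSingularities.ResolutionOfSingularities.Cruxes.EquisingularLiftNatThree.ToricTowers.R23

/-! ## Part A — support function, stars, replay of the optimal nodes-first words -/

abbrev Ray := ℤ × ℤ × ℤ

def dot (r m : Ray) : ℤ := r.1 * m.1 + r.2.1 * m.2.1 + r.2.2 * m.2.2

/-- the two vertices of the Newton segment `S_k` of `α(uv)²+εy^{2k}` (weights `(a,b,c)` of `(u,v,y)`). -/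
def vtx₁ : Ray := (2, 2, 0)
def vtx₂ (k : ℕ) : Ray := (0, 0, 2 * k)

/-- support function of the node germ. -/
def h (k : ℕ) (r : Ray) : ℤ := min (dot r vtx₁) (dot r (vtx₂ k))

/-- total excess of a face w.r.t. a vertex; `ord` = the smaller of the two (order of the strict transform along `V(face)`). -/
def excess (k : ℕ) (c : List Ray) (m : Ray) : ℤ := (c.map fun r => dot r m - h k r).sum
def ord (k : ℕ) (c : List Ray) : ℤ := min (excess k c vtx₁) (excess k c (vtx₂ k))

/-- `h k` is linear on the cone spanned by `c` iff one vertex is minimal at every ray (`ord = 0`). -/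
def linearOn (k : ℕ) (c : List Ray) : Bool := ord k c == 0

def det3 : List Ray → ℤ
  | [a, b, d] => a.1 * (b.2.1 * d.2.2 - b.2.2 * d.2.1) - a.2.1 * (b.1 * d.2.2 - b.2.2 * d.1) + a.2.2 * (b.1 * d.2.1 - b.2.1 * d.1)
  | _ => 0

def regularFan (F : List (List Ray)) : Bool := F.all fun c => (det3 c).natAbs == 1
def resolvedOn (k : ℕ) (F : List (List Ray)) : Bool := F.all (linearOn k)
def singularCones (k : ℕ) (F : List (List Ray)) : List (List Ray) := F.filter fun c => decide (2 ≤ ord k c)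

def vsum (c : List Ray) : Ray := c.foldl (fun s r => (s.1 + r.1, s.2.1 + r.2.1, s.2.2 + r.2.2)) (0, 0, 0)
def isSub (τ c : List Ray) : Bool := τ.all fun t => c.contains t

/-- regular (barycentric) star subdivision of the fan `F` at the face `τ`. -/
def star (F : List (List Ray)) (τ : List Ray) : List (List Ray) :=
  F.foldr (fun c acc => if isSub τ c then (τ.map fun t => (c.filter fun r => r != t) ++ [vsum τ]) ++ acc else c :: acc) []

/-- play a word (list of faces, starred in order). -/
def play (F : List (List Ray)) : List (List Ray) → List (List Ray)
  | [] => F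
  | τ :: w => play (star F τ) w

/-- every face of the word is a singular-locus centre (`ord ≥ 2`) and a face of the current fan at the time it is starred. -/
def legal (k : ℕ) (F : List (List Ray)) : List (List Ray) → Bool
  | [] => true
  | τ :: w => (decide (2 ≤ ord k τ) && F.any (isSub τ)) && legal k (star F τ) w

def e₁ : Ray := (1, 0, 0)
def e₂ : Ray := (0, 1, 0)
def e₃ : Ray := (0, 0, 1)
def orthant : List (List Ray) := [[e₁, e₂, e₃]]

/-- the node point `P` is a singular point of order 4 ≥ 2 for every `k ≥ 1` (rows k = 1..4), and the branch faces are singular. -/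
theorem orthant_singular :
    (ord 1 [e₁, e₂, e₃], ord 2 [e₁, e₂, e₃], ord 3 [e₁, e₂, e₃], ord 4 [e₁, e₂, e₃]) = (2, 4, 4, 4) ∧
    (ord 1 [e₁, e₃], ord 2 [e₁, e₃], ord 3 [e₁, e₃]) = (2, 2, 2) ∧ (ord 1 [e₁, e₂], ord 5 [e₁, e₂]) = (0, 0) := by decide

/-- optimal nodes-first word, k = 2 (nodegame_sym.py): σ_P, then the GLOBAL pair Γ̄ = {e₁,e₃} ‖ {e₂,e₃}, then the GLOBAL pair
Γ′ = {e₁,(1,0,1)} ‖ {e₂,(0,1,1)} — 1 local + 2 global moves. -/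
def word₂ : List (List Ray) := [[e₁, e₂, e₃], [e₁, e₃], [e₂, e₃], [e₁, (1, 0, 1)], [e₂, (0, 1, 1)]]

theorem word₂_wins :
    legal 2 orthant word₂ = true ∧ regularFan (play orthant word₂) = true ∧ resolvedOn 2 (play orthant word₂) = true ∧
    (play orthant word₂).length = 7 := by decide

/-- … and no proper prefix of it wins (the word is tight move by move). -/
theorem word₂_prefixes_lose :
    (resolvedOn 2 (play orthant (word₂.take 1)), resolvedOn 2 (play orthant (word₂.take 3)),
      resolvedOn 2 (play orthant (word₂.take 4))) = (false, false, false) := by decide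

/-- optimal nodes-first word, k = 1: σ_P, Γ̄ (pair), then the LOCAL line e_P = E_P ∩ Ē_ℓ = {e₃,(1,1,1)} — 2 local + 1 global. -/
def word₁ : List (List Ray) := [[e₁, e₂, e₃], [e₁, e₃], [e₂, e₃], [e₃, (1, 1, 1)]]

theorem word₁_wins :
    legal 1 orthant word₁ = true ∧ regularFan (play orthant word₁) = true ∧ resolvedOn 1 (play orthant word₁) = true ∧
    resolvedOn 1 (play orthant (word₁.take 3)) = false := by decide

/-- optimal nodes-first word, k = 3: σ_P; Γ̄, Γ′, Γ″ (three GLOBAL pairs); then the LOCAL mirror pair of lines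
λ_P = {e₁,(1,1,1)}, μ_P = {e₂,(1,1,1)} in E_P — 3 local + 3 global (Q47₃: 2 + 27 + 3 = 32 moves). -/
def word₃ : List (List Ray) :=
  [[e₁, e₂, e₃], [e₁, e₃], [e₂, e₃], [e₁, (1, 0, 1)], [e₂, (0, 1, 1)], [e₁, (2, 0, 1)], [e₂, (0, 2, 1)],
   [e₁, (1, 1, 1)], [e₂, (1, 1, 1)]]

theorem word₃_wins :
    legal 3 orthant word₃ = true ∧ regularFan (play orthant word₃) = true ∧ resolvedOn 3 (play orthant word₃) = true ∧
    (play orthant word₃).length = 13 ∧ resolvedOn 3 (play orthant (word₃.take 7)) = false := by decide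

/-- THE RECURSION k ↦ k − 2 at the fan level: after σ_P the cone `C_y = cone(e₁,e₂,w)`, `w = (1,1,1)`, carries in its own
regular coordinates `(μ₁, μ₂, λ) ↦ μ₁e₁ + μ₂e₂ + λw` the excess `h k − 4λ = min (2μ₁+2μ₂) ((2k−4)λ) = h (k−2) (μ₁,μ₂,λ)`. -/
theorem recursion (k : ℕ) (hk : 2 ≤ k) (μ₁ μ₂ l : ℤ) :
    h k (μ₁ + l, μ₂ + l, l) - 4 * l = h (k - 2) (μ₁, μ₂, l) := by
  obtain ⟨j, rfl⟩ : ∃ j, k = j + 2 := ⟨k - 2, by omega⟩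
  simp only [h, dot, vtx₁, vtx₂, Nat.add_sub_cancel]
  push_cast
  rw [← min_sub_sub_right]
  congr 1 <;> ring

/-! ## Part B — carriers first: walls `a + b = j·c`, singular faces, two points per node -/

/-- gcd of the 2×2 minors of the pair of rays `(j,0,1), (0,j,1)` spanning the wall face `F_j`: the minors are `j², j, −j`. -/
def faceIndex (j : ℕ) : ℕ := Nat.gcd (Nat.gcd (j * j) j) j

theorem faceIndex_eq (j : ℕ) : faceIndex j = j := by
  simp [faceIndex, Nat.gcd_mul_left_left]

/-- lattice length of the segment direction `(2,2,−2k) ~ (2,2,2k)`: two intersection points of St H with the `j = k` line per node. -/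
theorem latticeLength_two (k : ℕ) : Nat.gcd (Nat.gcd 2 2) (2 * k) = 2 := by
  simp

/-- `h k` is linear (= 2a+2b) on the wall pieces `a + b ≤ k·c` and (= 2kc) on `a + b ≥ k·c`. -/
theorem wall_linear_low (k : ℕ) (a b c : ℤ) (hw : a + b ≤ k * c) : h k (a, b, c) = 2 * a + 2 * b := by
  simp only [h, dot, vtx₁, vtx₂]; rw [min_eq_left] <;> nlinarith
theorem wall_linear_high (k : ℕ) (a b c : ℤ) (hw : (k : ℤ) * c ≤ a + b) : h k (a, b, c) = 2 * k * c := by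
  simp only [h, dot, vtx₁, vtx₂]; rw [min_eq_right] <;> nlinarith

/-- non-linearity certificate on the quadric cone `Q = cone(e₁,e₂,e₁+e₃,e₂+e₃)` (after W₁'s nodal wall `c = a+b`):
`(1,1,1) = e₁ + (0,1,1)` but `h k (1,1,1) = 4 > 0 + 2` for `k ≥ 2` (superadditive `h`, strict ⇒ not linear: St H passes through
the ODP vertex); equality for `k = 1` (Q47: the 9 ODPs are OFF T̃″, lead-1). Rows k = 1, 2, 3. -/
theorem quadric_cone_rows :
    (h 1 (1,1,1), h 1 e₁ + h 1 (0,1,1)) = (2, 2) ∧ (h 2 (1,1,1), h 2 e₁ + h 2 (0,1,1)) = (4, 2) ∧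
    (h 3 (1,1,1), h 3 e₁ + h 3 (0,1,1)) = (4, 2) := by decide

/-- after the second wall (k = 2): `h 2` IS linear on both pieces `Q₁ = {c ≤ a+b ≤ 2c}` ∋ (1,0,1),(0,1,1),(2,0,1),(0,2,1) and
`Q₂ = {a+b ≥ 2c}` ∋ e₁,e₂,(2,0,1),(0,2,1) (toroidally resolved), while the shared face `F₂ = cone((2,0,1),(0,2,1))` has index 2
(a cA₁ line, lead-1's `{uv = γy²}`) met by St H in latticeLength = 2 points: 9 × 2 = 18 A₁ points on Q47₂ (lead-1 §11 B3). -/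
theorem second_wall_k2 :
    linearOn 2 [(1,0,1), (0,1,1), (2,0,1), (0,2,1)] = true ∧ linearOn 2 [e₁, e₂, (2,0,1), (0,2,1)] = true ∧
    faceIndex 2 = 2 ∧ 9 * Nat.gcd (Nat.gcd 2 2) (2 * 2) = 18 := by decide

/-! ## Part C — pinch points are mixed volumes -/

/-- `2·MV(P,Q) = 2·area(P+Q) − 2·area(P) − 2·area(Q)` for `P = Δ(D) = conv{0,(4,0),(0,7)}`, `Q = conv{0,(8+k,0),(0,16+2k)}`,
`P + Q = conv{0,(12+k,0),(4,16+2k),(0,23+2k)}` (shoelace): equals `2·(64 + 8k)`. -/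
theorem pinch_count (k : ℤ) :
    ((12 + k) * (16 + 2 * k) + 4 * (23 + 2 * k)) - 28 - (8 + k) * (16 + 2 * k) = 2 * (64 + 8 * k) := by ring

/-- the same number as `(8+k)·(Γ₀·D_X)` with `Γ₀·D_X = 8` (lead-1 (D): 72 = Γ₀·9D_X), rows k = 1..4: 72, 80, 88, 96 —
and the degree of `P_k(s) = T₇(s)^{8+k} + 1 + T₄(s)^{16+2k}` is `max (7(8+k)) (4(16+2k)) = 64 + 8k`. -/
theorem pinch_rows :
    (List.range 4).map (fun i => (64 + 8 * (i + 1), (8 + (i + 1)) * 8, max (7 * (8 + (i + 1))) (4 * (16 + 2 * (i + 1))))) =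
      [(72, 72, 72), (80, 80, 80), (88, 88, 88), (96, 96, 96)] := by decide

theorem pinch_degree (k : ℕ) : max (7 * (8 + k)) (4 * (16 + 2 * k)) = 64 + 8 * k := by omega

/-! ## Part D — measured optima and the quadratic law -/

/-- `(k, L, G)` = (gap parameter, LOCAL moves per node, GLOBAL curve rounds) of the optimal symmetric nodes-first node package,
singular-locus centres (nodegame_sym.py, in-seat; EL-legal variant identical for k ≤ 3; kit j324391 extends). -/
def measured : List (ℕ × ℕ × ℕ) := [(1, 2, 1), (2, 1, 2), (3, 3, 3), (4, 6, 4), (5, 10, 5)]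

def lawL (k : ℕ) : ℕ := k * (k - 1) / 2
def wordLen (r L G : ℕ) : ℕ := 2 + r * L + G

theorem law_matches : (measured.filter fun t => 2 ≤ t.1).all (fun t => t.2.1 == lawL t.1 && t.2.2 == t.1) = true := by decide

/-- Q47_k (r = 9 nodes) nodes-first word lengths k = 1..5: 21, 13, 32, 60, 97; conjectured k = 6: 2 + 9·15 + 6 = 143. -/
theorem q47_word_lengths :
    measured.map (fun t => wordLen 9 t.2.1 t.2.2) = [21, 13, 32, 60, 97] ∧ wordLen 9 (lawL 6) 6 = 143 := by decide

/-- the recursion behind the law: `L(k) = 1 + L_loc(k−2)` with the all-local sub-game cost `L_loc(j) = (j+1)(j+2)/2 − 1`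
(observed j = 0..3: 0, 2, 5, 9) is the same as `L(k) = k(k−1)/2` for k ≥ 2. -/
theorem law_recursion (k : ℕ) (hk : 2 ≤ k) : lawL k = 1 + ((k - 2 + 1) * (k - 2 + 2) / 2 - 1) := by
  obtain ⟨j, rfl⟩ : ∃ j, k = j + 2 := ⟨k - 2, by omega⟩
  simp only [lawL, Nat.add_sub_cancel]
  have h1 : (j + 2) * (j + 2 - 1) = (j + 1) * (j + 2) := by
    rw [show j + 2 - 1 = j + 1 from rfl]; ring
  rw [h1]
  have h2 : 1 ≤ (j + 1) * (j + 2) / 2 := by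
    apply Nat.le_div_iff_mul_le (by norm_num) |>.mpr
    nlinarith
  omega

/-! ## Part E — scar persistence (local algebra, Mathlib only) -/

section Scar
open IsLocalRing

variable {A B : Type*} [CommRing A] [CommRing B] [IsLocalRing A] [IsLocalRing B]

/-- **Scar persistence.** If the uniformiser lies in `𝔪_A²` (the special fibre is singular at the point, for `A` regular of
dimension ≥ 1) then its image under any LOCAL homomorphism lies in `𝔪_B²` — in particular at every point of every later
blow-up lying over the point.  (The consequence «no regular O-flat centre through such a point has regular special fibre
there» is ✓p569735, lead-1.) -/
theorem scar_persists (φ : A →+* B) [IsLocalHom φ] {ϖ : A} (hϖ : ϖ ∈ maximalIdeal A ^ 2) :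
    φ ϖ ∈ maximalIdeal B ^ 2 := by
  have hle : (maximalIdeal A).map φ ≤ maximalIdeal B :=
    Ideal.map_le_iff_le_comap.mpr fun a ha => map_nonunit φ a ha
  have hmem : φ ϖ ∈ (maximalIdeal A ^ 2).map φ := Ideal.mem_map_of_mem φ hϖ
  rw [Ideal.map_pow] at hmem
  exact Ideal.pow_right_mono hle 2 hmem

/-- the same along a chain of local homomorphisms (a history read upstairs point by point). -/
theorem scar_persists_comp {C : Type*} [CommRing C] [IsLocalRing C] (φ : A →+* B) (ψ : B →+* C) [IsLocalHom φ]
    [IsLocalHom ψ] {ϖ : A} (hϖ : ϖ ∈ maximalIdeal A ^ 2) : ψ (φ ϖ) ∈ maximalIdeal C ^ 2 :=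
  scar_persists ψ (scar_persists φ hϖ)

end Scar

end Summit.ResolutionOfSingularities.ResolutionOfSingularities.Cruxes.EquisingularLiftNatThree.ToricTowers.R23
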